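import Literature.Probability.RandomPlanarGeometry.HexSAWStripWidthThreeCritical
import HarnessLib

/-!
# The width-three strip at criticality: the critical irreducible kernel of `S₃` has surface-contact moments of EVERY order
# (module «WIDTH-THREE-MOMENTS»)

Topic `Literature/Probability/RandomPlanarGeometry` (continues «WIDTH-THREE-KERNEL» `HexSAWStripWidthThreeKernel.lean` — the classification
`W3.HBk_three_pair/triple/serp/empty` of the irreducible bridges of `S₃` (ten short lists and the serpentines `serpUp K`, `serpDn K` of weight
`x_c^{6K} y^K` with exactly `K` surface contacts) — and «WIDTH-THREE-CRITICAL» `HexSAWStripWidthThreeCritical.lean` — `W3.xc_pow_six_mul_stripYT_three_lt_one`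
(`x_c⁶ y₃ < 1`), `W3.sum_topCntSq_wD_le`, ★ `W3.widthThree_summable_contactSqIrr` = the SECOND-moment hypothesis `hC2` of the lane's weak laws
(«CONTACT-LLN» #750, «BETA-CONTACT-LLN» #770) at `T = 3`).  Lane «pcv-sawmu» (CriticalPhenomena venture), a-p2 g26.  The second moment was all
#750/#770 needed; a central limit theorem for the surface contacts (Feller XIII.6, second half — Lyapunov / characteristic functions on the renewal
equation; NOT in the tree) needs the THIRD, and a moment-method proof needs ALL of them.  Here: at `T = 3` every contact moment of the critical
irreducible kernel is finite, with the explicit bound `1 + y₃ + Σ_n n^p (x_c⁶y₃)^n` uniform in the truncation — because the kernel is rational in `y`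
with radius `x_c^{−6} = 13.6… ≫ y₃ = 2.89…`.  Sources of the SETTING: H. Duminil-Copin, A. Hammond, CMP 324 (2013) §2.2 (irreducible bridges);
N. R. Beaton, M. Bousquet-Mélou, J. de Gier, H. Duminil-Copin, A. J. Guttmann, CMP 326 (2014) §3.2 (the strip `S_T` at `(x_c, y_T)`); W. Feller I (1968)
XIII.6 (moments of the number of renewals).  Nothing below is printed.

## What is proved (namespace `Literature.Probability.RandomPlanarGeometry.SAW.HV.W3`)

* ★ `sum_topCntPow_wD_le (p) : Σ_{l ∈ HBk 3 N 1 a b} #top(l.tail)^p · wD(l) ≤ 1 + y + Σ' n, n^p (x_c⁶y)^n` for every `p : ℕ`, `0 ≤ y`, `x_c⁶y < 1`,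
  uniformly in `N, a, b` (short classes: one list with `#top ≤ 1`; serpentine classes: `Σ_K K^p (x_c⁶y)^K`; the rest empty) — `p = 2` is #845's lemma.
* ★★★ **`widthThree_summable_contactPowIrr (p) (a b) : Summable (k ↦ Σ_{l ∈ LMset 3 (2k+1) n_k a b} #top(l.tail)^p · wD 3 y₃ l)`** — the `p`-th
  contact moment of the critical irreducible kernel of `S₃` is finite along every hat class, for EVERY `p` (`hCp`; `p = 2` = #845's `hC2`).
* ★★ `widthThree_tsum_contactPowIrr_le (p) (a b)` — the explicit bound `Σ' k (…) ≤ 1 + y₃ + Σ' n, n^p (x_c⁶y₃)^n`.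

Label: LANE THEOREM (own result of lane «pcv-sawmu», a-p2 g26, 2026-08-27; not in print).  NOT claimed: the CLT itself; length moments (same proof,
omitted); any `T ≥ 4`.
-/

noncomputable section

open Finset Filter Topology Matrix Literature.Probability.LatticeModels Literature.Probability.Percolation

namespace Literature.Probability.RandomPlanarGeometry.SAW

namespace HV

namespace W3

/-- ★ **Every contact moment of a level class of `S₃` is bounded uniformly in the truncation**: for `p : ℕ`, `0 ≤ y` with `x_c⁶y < 1` and all
`N, a, b`, `Σ_{l ∈ HBk 3 N 1 a b} #top(l.tail)^p · wD(l) ≤ 1 + y + Σ_n n^p (x_c⁶y)^n` (short classes: one list with `#top ≤ 1`, weight `≤ max(1, y)`;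
serpentine classes: `Σ_K K^p (x_c⁶y)^K`; the rest empty).  `p = 2` is `sum_topCntSq_wD_le` of «WIDTH-THREE-CRITICAL» (same proof).
[cite: DuminilCopinHammond2013, §2.2; Feller1968, XIII.6; lane «pcv-sawmu» a-p2 g26 — own result] -/
theorem sum_topCntPow_wD_le (p : ℕ) {y : ℝ} (hy : 0 ≤ y) (hy' : hexCriticalFugacity ^ 6 * y < 1) (N : ℕ) (a b : ℤ) :
    ∑ l ∈ HBk 3 N 1 a b, (topCnt 3 l.tail : ℝ) ^ p * wD 3 y l ≤
      1 + y + ∑' n : ℕ, ((n : ℝ) ^ p * (hexCriticalFugacity ^ 6 * y) ^ n) := by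
  set q : ℝ := hexCriticalFugacity ^ 6 * y with hq
  have hq0 : 0 ≤ q := mul_nonneg (pow_nonneg hexCriticalFugacity_pos_lt_one.1.le _) hy
  have hsum : Summable fun n : ℕ => (n : ℝ) ^ p * q ^ n :=
    summable_pow_mul_geometric_of_norm_lt_one p (by rw [Real.norm_eq_abs, abs_of_nonneg hq0]; exact hy')
  have htsum0 : 0 ≤ ∑' n : ℕ, (n : ℝ) ^ p * q ^ n := tsum_nonneg fun n => mul_nonneg (pow_nonneg (Nat.cast_nonneg _) _) (pow_nonneg hq0 _)
  have hx1 : hexCriticalFugacity ≤ 1 := hexCriticalFugacity_pos_lt_one.2.le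
  have hx0 : 0 ≤ hexCriticalFugacity := hexCriticalFugacity_pos_lt_one.1.le
  have hnn : ∀ l : List HV, 0 ≤ (topCnt 3 l.tail : ℝ) ^ p * wD 3 y l := fun l =>
    mul_nonneg (pow_nonneg (Nat.cast_nonneg _) _) (wD_nonneg 3 hy l)
  -- reduce to `N ≥ 2` by monotonicity
  have hmono : ∑ l ∈ HBk 3 N 1 a b, (topCnt 3 l.tail : ℝ) ^ p * wD 3 y l ≤
      ∑ l ∈ HBk 3 (max N 2) 1 a b, (topCnt 3 l.tail : ℝ) ^ p * wD 3 y l :=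
    Finset.sum_le_sum_of_subset_of_nonneg (HBk_mono (le_max_left N 2) 1 a b) fun l _ _ => hnn l
  refine hmono.trans ?_
  set M := max N 2 with hM
  have hM2 : 2 ≤ M := le_max_right N 2
  -- a one-list class contributes `#top^p · wD ≤ 1 + y`
  have hone : ∀ L : List HV, L.length ≤ 3 → topCnt 3 L.tail ≤ 1 →
      ∑ l ∈ ({L} : Finset (List HV)), (topCnt 3 l.tail : ℝ) ^ p * wD 3 y l ≤ 1 + y + ∑' n : ℕ, (n : ℝ) ^ p * q ^ n := by
    intro L hL ht
    rw [Finset.sum_singleton]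
    have hw : wD 3 y L ≤ 1 + y := by
      rw [wD]
      have hp : hexCriticalFugacity ^ (L.length - 1) ≤ 1 := pow_le_one₀ hx0 hx1
      interval_cases h : topCnt 3 L.tail
      · rw [pow_zero, mul_one]; linarith
      · rw [pow_one]; nlinarith
    have ht' : (topCnt 3 L.tail : ℝ) ^ p ≤ 1 := by
      have : (topCnt 3 L.tail : ℝ) ≤ 1 := by exact_mod_cast ht
      exact pow_le_one₀ (Nat.cast_nonneg _) this
    have h0 : 0 ≤ (topCnt 3 L.tail : ℝ) ^ p := pow_nonneg (Nat.cast_nonneg _) _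
    nlinarith [wD_nonneg 3 hy L]
  obtain ⟨h01, h10, h23, h32, h45, h54⟩ := HBk_three_pair (by omega : 1 ≤ M)
  obtain ⟨h02, h31, h24, h53⟩ := HBk_three_triple hM2
  obtain ⟨h15, h40⟩ := HBk_three_serp M
  -- the serpentine classes contribute `Σ_{K < M/6} (K+1)^p q^{K+1} ≤ Σ_n n^p q^n`
  have hserp : ∀ (f : ℕ → List HV), (∀ K, (f K).length = 6 * K + 1) → (∀ K, wD 3 y (f K) = hexCriticalFugacity ^ (6 * K) * y ^ K) →
      (∀ K, topCnt 3 (f K).tail = K) →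
      ∑ l ∈ (Finset.range (M / 6)).image (fun K => f (K + 1)), (topCnt 3 l.tail : ℝ) ^ p * wD 3 y l ≤
        1 + y + ∑' n : ℕ, (n : ℝ) ^ p * q ^ n := by
    intro f hlen hw ht
    rw [Finset.sum_image (fun K _ K' _ h => by have := congrArg List.length h; rw [hlen, hlen] at this; omega)]
    have hterm : ∀ K, (topCnt 3 (f (K + 1)).tail : ℝ) ^ p * wD 3 y (f (K + 1)) = ((K + 1 : ℕ) : ℝ) ^ p * q ^ (K + 1) := fun K => by
      rw [ht, hw, hq, mul_pow, ← pow_mul]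
    simp only [hterm]
    have h1 : ∑ K ∈ Finset.range (M / 6), ((K + 1 : ℕ) : ℝ) ^ p * q ^ (K + 1) ≤ ∑' n : ℕ, (n : ℝ) ^ p * q ^ n := by
      have hinj : ∀ x ∈ Finset.range (M / 6), ∀ x' ∈ Finset.range (M / 6), x + 1 = x' + 1 → x = x' := by
        intro x _ x' _ h; omega
      calc ∑ K ∈ Finset.range (M / 6), ((K + 1 : ℕ) : ℝ) ^ p * q ^ (K + 1)
          = ∑ n ∈ ((Finset.range (M / 6)).image (fun K : ℕ => K + 1) : Finset ℕ), ((n : ℕ) : ℝ) ^ p * q ^ n := by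
            rw [Finset.sum_image hinj]
        _ ≤ ∑' n : ℕ, (n : ℝ) ^ p * q ^ n :=
            hsum.sum_le_tsum _ fun n _ => mul_nonneg (pow_nonneg (Nat.cast_nonneg _) _) (pow_nonneg hq0 _)
    linarith
  by_cases hab : (a = 0 ∧ b = 1) ∨ (a = 0 ∧ b = 2) ∨ (a = 1 ∧ b = 0) ∨ (a = 2 ∧ b = 3) ∨ (a = 2 ∧ b = 4) ∨ (a = 3 ∧ b = 2) ∨
      (a = 3 ∧ b = 1) ∨ (a = 4 ∧ b = 5) ∨ (a = 5 ∧ b = 4) ∨ (a = 5 ∧ b = 3) ∨ (a = 1 ∧ b = 5) ∨ (a = 4 ∧ b = 0)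
  · rcases hab with ⟨rfl, rfl⟩ | ⟨rfl, rfl⟩ | ⟨rfl, rfl⟩ | ⟨rfl, rfl⟩ | ⟨rfl, rfl⟩ | ⟨rfl, rfl⟩ | ⟨rfl, rfl⟩ | ⟨rfl, rfl⟩ |
        ⟨rfl, rfl⟩ | ⟨rfl, rfl⟩ | ⟨rfl, rfl⟩ | ⟨rfl, rfl⟩
    · rw [h01]; exact hone _ (by simp [W2.irr01]) (by simp [W2.irr01, topCnt, bit])
    · rw [h02]; exact hone _ (by simp [W2.irr02]) (by simp [W2.irr02, topCnt, bit])
    · rw [h10]; exact hone _ (by simp [W2.irr10]) (by simp [W2.irr10, topCnt, bit])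
    · rw [h23]; exact hone _ (by simp [W2.irr23]) (by simp [W2.irr23, topCnt, bit])
    · rw [h24]; exact hone _ (by simp [irr24]) (by simp [irr24, topCnt, bit])
    · rw [h32]; exact hone _ (by simp [W2.irr32]) (by simp [W2.irr32, topCnt, bit])
    · rw [h31]; exact hone _ (by simp [W2.irr31]) (by simp [W2.irr31, topCnt, bit])
    · rw [h45]; exact hone _ (by simp [irr45]) (by simp [irr45, topCnt, bit])
    · rw [h54]; exact hone _ (by simp [irr54]) (by simp [irr54, topCnt, bit])
    · rw [h53]; exact hone _ (by simp [irr53]) (by simp [irr53, topCnt, bit])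
    · rw [show ((1 : ℤ) : ℤ) = ((1 : Fin (2 * 3)) : ℕ) from rfl] at h15 ⊢
      rw [show ((5 : ℤ) : ℤ) = ((5 : Fin (2 * 3)) : ℕ) from rfl] at h15 ⊢
      rw [h15]; exact hserp serpUp length_serpUp (wD_serpUp · y) topCnt_serpUp_tail
    · rw [show ((4 : ℤ) : ℤ) = ((4 : Fin (2 * 3)) : ℕ) from rfl] at h40 ⊢
      rw [show ((0 : ℤ) : ℤ) = ((0 : Fin (2 * 3)) : ℕ) from rfl] at h40 ⊢
      rw [h40]; exact hserp serpDn length_serpDn (wD_serpDn · y) topCnt_serpDn_tail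
  · rw [HBk_three_empty hab, Finset.sum_empty]
    linarith

/-- The partial sums of the `p`-th contact moment along the hat classes are bounded by the class bound (plumbing: the slices `k < M` are pairwise
disjoint pieces of `HBk 3 (2M+1) 1 a b`). [cite: DuminilCopinHammond2013, §2.2; lane plumbing a-p2 g26] -/
theorem sum_range_contactPowIrr_le (p : ℕ) (a b : Fin (2 * 3)) (M : ℕ) :
    ∑ k ∈ Finset.range M, ∑ l ∈ LMset 3 (2 * k + 1) (hatLen k a b) (a : ℕ) (b : ℕ), (topCnt 3 l.tail : ℝ) ^ p * wD 3 (stripYT 3) l ≤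
      1 + stripYT 3 + ∑' n : ℕ, ((n : ℝ) ^ p * (hexCriticalFugacity ^ 6 * stripYT 3) ^ n) := by
  have hy : 0 ≤ stripYT 3 := (stripYT_pos (by norm_num)).le
  have hsub : ∀ k ∈ Finset.range M, LMset 3 (2 * k + 1) (hatLen k a b) (a : ℕ) (b : ℕ) ⊆ HBk 3 (2 * M + 1) 1 (a : ℕ) (b : ℕ) := by
    intro k hk l hl
    rw [Finset.mem_range] at hk
    rw [LMset, Finset.mem_filter] at hl
    exact HBk_mono (by omega) 1 _ _ hl.1
  have hdisj : (Finset.range M : Set ℕ).PairwiseDisjoint fun k => LMset 3 (2 * k + 1) (hatLen k a b) (a : ℕ) (b : ℕ) := by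
    intro k _ k' _ hkk'
    rw [Function.onFun, Finset.disjoint_left]
    intro l hl hl'
    rw [LMset, Finset.mem_filter] at hl hl'
    have := hl.2.symm.trans hl'.2
    unfold hatLen at this
    exact hkk' (by omega)
  calc ∑ k ∈ Finset.range M, ∑ l ∈ LMset 3 (2 * k + 1) (hatLen k a b) (a : ℕ) (b : ℕ), (topCnt 3 l.tail : ℝ) ^ p * wD 3 (stripYT 3) l
      = ∑ l ∈ (Finset.range M).biUnion (fun k => LMset 3 (2 * k + 1) (hatLen k a b) (a : ℕ) (b : ℕ)),
          (topCnt 3 l.tail : ℝ) ^ p * wD 3 (stripYT 3) l := (Finset.sum_biUnion hdisj).symm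
    _ ≤ ∑ l ∈ HBk 3 (2 * M + 1) 1 (a : ℕ) (b : ℕ), (topCnt 3 l.tail : ℝ) ^ p * wD 3 (stripYT 3) l :=
        Finset.sum_le_sum_of_subset_of_nonneg (Finset.biUnion_subset.2 hsub) fun l _ _ =>
          mul_nonneg (pow_nonneg (Nat.cast_nonneg _) _) (wD_nonneg 3 hy l)
    _ ≤ _ := sum_topCntPow_wD_le p hy xc_pow_six_mul_stripYT_three_lt_one _ _ _

/-- ★★★ **`hCp` at `T = 3` for every `p`**: the `p`-th contact moment of the critical irreducible kernel of `S₃` is finite along every hat class —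
`Summable (k ↦ Σ_{l ∈ LMset 3 (2k+1) n_k a b} #top(l.tail)^p · wD 3 y₃ l)` (`p = 2` is `widthThree_summable_contactSqIrr`, the hypothesis of the
lane's weak laws; `p = 3` is what a Lyapunov central limit theorem will ask; all `p` together, what a moment-method proof will ask).
[cite: Feller1968, XIII.6; DuminilCopinHammond2013, §2.2; BeatonBousquetMelouDeGierDuminilCopinGuttmann2014, §3.2; lane «pcv-sawmu» a-p2 g26 — own result, not in print] -/
theorem widthThree_summable_contactPowIrr (p : ℕ) (a b : Fin (2 * 3)) :
    Summable fun k : ℕ => ∑ l ∈ LMset 3 (2 * k + 1) (hatLen k a b) (a : ℕ) (b : ℕ), (topCnt 3 l.tail : ℝ) ^ p * wD 3 (stripYT 3) l := by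
  have hy : 0 ≤ stripYT 3 := (stripYT_pos (by norm_num)).le
  have hnn : ∀ k, 0 ≤ ∑ l ∈ LMset 3 (2 * k + 1) (hatLen k a b) (a : ℕ) (b : ℕ), (topCnt 3 l.tail : ℝ) ^ p * wD 3 (stripYT 3) l :=
    fun k => Finset.sum_nonneg fun l _ => mul_nonneg (pow_nonneg (Nat.cast_nonneg _) _) (wD_nonneg 3 hy l)
  exact summable_of_sum_range_le hnn (sum_range_contactPowIrr_le p a b)

/-- ★★ **The explicit uniform bound on the `p`-th contact moment of the critical `S₃` kernel**:
`Σ' k, Σ_{l ∈ LMset 3 (2k+1) n_k a b} #top^p · wD 3 y₃ l ≤ 1 + y₃ + Σ' n, n^p (x_c⁶y₃)^n`.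
[cite: Feller1968, XIII.6; DuminilCopinHammond2013, §2.2; lane «pcv-sawmu» a-p2 g26 — own result] -/
theorem widthThree_tsum_contactPowIrr_le (p : ℕ) (a b : Fin (2 * 3)) :
    (∑' k : ℕ, ∑ l ∈ LMset 3 (2 * k + 1) (hatLen k a b) (a : ℕ) (b : ℕ), (topCnt 3 l.tail : ℝ) ^ p * wD 3 (stripYT 3) l) ≤
      1 + stripYT 3 + ∑' n : ℕ, ((n : ℝ) ^ p * (hexCriticalFugacity ^ 6 * stripYT 3) ^ n) := by
  have hy : 0 ≤ stripYT 3 := (stripYT_pos (by norm_num)).le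
  have hnn : ∀ k, 0 ≤ ∑ l ∈ LMset 3 (2 * k + 1) (hatLen k a b) (a : ℕ) (b : ℕ), (topCnt 3 l.tail : ℝ) ^ p * wD 3 (stripYT 3) l :=
    fun k => Finset.sum_nonneg fun l _ => mul_nonneg (pow_nonneg (Nat.cast_nonneg _) _) (wD_nonneg 3 hy l)
  exact Real.tsum_le_of_sum_range_le hnn (sum_range_contactPowIrr_le p a b)

end W3

end HV

end Literature.Probability.RandomPlanarGeometry.SAW
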